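import Literature.Probability.RandomPlanarGeometry.SAWBendingEnergy
import Literature.Probability.RandomPlanarGeometry.SAWUnfolding
import Literature.Probability.RandomPlanarGeometry.SAWBridgeRenewalEquation
import HarnessLib

/-!
# All-turn walks under Hammersley–Welsh unfolding and under bridge concatenation («L-POLY» S5, S6)

Topic `Literature/Probability/RandomPlanarGeometry` (continues `SAWBendingEnergy.lean` — `Zd.turnAt`, `Zd.turns` —,
`SAWUnfolding.lean` — the Hammersley–Welsh unfolding `unfold`, `card_le_exp_mul_card_image_unfold`,
`unfold_mem_bridges`, `iterate_unfoldStep_apply_of_ne` — and `SAWBridges.lean` / `SAWBridgeRenewalEquation.lean` —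
`concatWalk`, `concatWalk_mem_bridges`, `concatWalk_injective_pieces`).

Statement (a-idea-2 gen 9, `Sketch_v9_LPOLY.lean` 481736c9b1289c6c, support items S5 `AllTurnUnfold` and S6
`AllTurnConcat` of the all-turn (`L`-lattice) Hammersley theorem «L-POLY», bodies verbatim as theorem types). This
file also DECLARES the planner's objects `allTurnWalksV`, `allTurnCountV`, `allTurnBridges`, `allTurnBridgeCount`,
`allTurnHalfSpaceWalks`, `allTurnHalfSpaceCount` (bodies verbatim, namespace `…SAW.Zd`; lead 13:04:14Z: the first
filer of the K1 chain declares them):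
* S5: `h^{AT}(n) ≤ e^{3√n} b^{AT}(n)` — the unfolding reflects suffixes in lines `x₀ = const`, so it does not touch
  the second coordinate; a self-avoiding walk turns at a vertex iff exactly one of the two incident steps is
  vertical; hence unfolding preserves the all-turn property (`turns_eq_of_apply_one_eq`);
* S6: `b^{AT}(2j) · b^{AT}(k) ≤ b^{AT}(2j + k)` — in an all-turn bridge step `s` is horizontal iff `s` is odd
  (`apply_one_sub_eq_zero_iff_odd`), so an even all-turn bridge ends with a vertical step, every bridge starts with
  `+e₀`, and the concatenation turns at the junction.
[cite: MadrasSlade1993, Proposition 3.1.5 and eq. (1.2.15)]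
-/

noncomputable section

open Finset Filter Topology
open scoped BigOperators
open Literature.Probability.LatticeModels Literature.Probability.Percolation

namespace Literature.Probability.RandomPlanarGeometry.SAW.Zd

/-! ### The all-turn classes (a-idea-2's `Sketch_v9_LPOLY` objects, bodies verbatim) -/

open Classical in
/-- `A_V(N)`: all-turn `N`-step SAWs from `0` whose FIRST step is vertical (`ω(1)₀ = 0`).
[cite: MadrasSlade1993, §3.1 (proof of Theorem 3.1.1)] -/
def allTurnWalksV (N : ℕ) : Finset (ℕ → Site 2) :=
  (Zd.saws 2 N).filter fun ω => Zd.turns N ω = N - 1 ∧ ω 1 0 = 0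

/-- `a_V(N) = #A_V(N)`. [cite: MadrasSlade1993, §3.1] -/
def allTurnCountV (N : ℕ) : ℕ := (allTurnWalksV N).card

open Classical in
/-- The all-turn `N`-step x-bridges (Madras–Slade Def. 1.2.4 bridges that turn at every internal vertex).
[cite: MadrasSlade1993, Definition 1.2.4] -/
def allTurnBridges (N : ℕ) : Finset (ℕ → Site 2) :=
  (Zd.bridges 2 N).filter fun ω => Zd.turns N ω = N - 1

/-- `b^{AT}(N)`. [cite: MadrasSlade1993, Definition 1.2.4] -/
def allTurnBridgeCount (N : ℕ) : ℕ := (allTurnBridges N).card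

open Classical in
/-- The all-turn `N`-step half-space walks (`ω₁(0) < ω₁(j)`, Def. 3.1.2). [cite: MadrasSlade1993, Definition 3.1.2] -/
def allTurnHalfSpaceWalks (N : ℕ) : Finset (ℕ → Site 2) :=
  (Zd.halfSpaceWalks 2 N).filter fun ω => Zd.turns N ω = N - 1

/-- `h^{AT}(N)`. [cite: MadrasSlade1993, Definition 3.1.2] -/
def allTurnHalfSpaceCount (N : ℕ) : ℕ := (allTurnHalfSpaceWalks N).card

/-! ### Steps of a self-avoiding walk on `ℤ²`, and turns via step types -/

/-- A step of `ℤ²`: `y − x = ± e_i`. [cite: MadrasSlade1993, §1.1] -/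
theorem sub_eq_single_or_of_adj {x y : Site 2} (h : (zdGraph 2).Adj x y) :
    ∃ i : Fin 2, y - x = Pi.single i 1 ∨ y - x = -Pi.single i 1 := by
  obtain ⟨i, h | h⟩ := (zdGraph_adj_iff x y).1 h
  · exact ⟨i, Or.inl (by rw [h]; abel)⟩
  · exact ⟨i, Or.inr (by rw [h]; abel)⟩

/-- For a self-avoiding walk, two consecutive steps are never opposite. [cite: MadrasSlade1993, §1.1] -/
theorem step_add_step_ne_zero {n : ℕ} {ω : ℕ → Site 2} (hω : ω ∈ saws 2 n) {j : ℕ} (hj : j + 2 ≤ n) :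
    (ω (j + 1) - ω j) + (ω (j + 2) - ω (j + 1)) ≠ 0 := by
  intro h
  have h' : ω (j + 2) = ω j := by
    have : ω (j + 2) - ω j = 0 := by rw [← h]; abel
    exact sub_eq_zero.1 this
  have hinj := (mem_saws.1 hω).2.2.2
  have := hinj (show j + 2 ∈ {i | i ≤ n} by simp; omega) (show j ∈ {i | i ≤ n} by simp; omega) h'
  omega

/-- **A self-avoiding walk on `ℤ²` turns at `j` iff exactly one of the steps `j → j+1`, `j+1 → j+2` is vertical.**
[cite: MadrasSlade1993, §1.1] -/
theorem turnAt_iff_types {n : ℕ} {ω : ℕ → Site 2} (hω : ω ∈ saws 2 n) {j : ℕ} (hj : j + 2 ≤ n) :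
    turnAt n ω j ↔ ((ω (j + 1) - ω j) 1 = 0 ↔ ¬ (ω (j + 2) - ω (j + 1)) 1 = 0) := by
  have hadj := (mem_saws.1 hω).2.2.1
  obtain ⟨a, ha⟩ := sub_eq_single_or_of_adj (hadj j (by omega))
  obtain ⟨b, hb⟩ := sub_eq_single_or_of_adj (hadj (j + 1) (by omega))
  have hne := step_add_step_ne_zero hω hj
  unfold turnAt
  simp only [hj, true_and]
  -- sixteen explicit cases
  fin_cases a <;> fin_cases b <;>
    rcases ha with ha | ha <;> rcases hb with hb | hb <;>
    rw [ha, hb] at hne ⊢ <;>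
    simp_all [Pi.single_apply, funext_iff, Fin.forall_fin_two]

/-- **Turns depend only on the step types**: two self-avoiding walks with the same second-coordinate profile have
the same number of turns. [cite: MadrasSlade1993, §1.1] -/
theorem turns_eq_of_apply_one_eq {n : ℕ} {ω ω' : ℕ → Site 2} (hω : ω ∈ saws 2 n) (hω' : ω' ∈ saws 2 n)
    (h : ∀ i ≤ n, ω' i 1 = ω i 1) : turns n ω' = turns n ω := by
  classical
  unfold turns Zd.occ
  refine congrArg Finset.card (Finset.filter_congr fun j _ => ?_)
  by_cases hj2 : j + 2 ≤ n
  · rw [turnAt_iff_types hω' hj2, turnAt_iff_types hω hj2, Pi.sub_apply, Pi.sub_apply, Pi.sub_apply,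
      Pi.sub_apply, h j (by omega), h (j + 1) (by omega), h (j + 2) hj2]
  · simp [turnAt, hj2]

/-! ### S5: unfolding keeps the all-turn property -/

/-- The Hammersley–Welsh unfolding does not touch the second coordinate. [cite: MadrasSlade1993, Proposition 3.1.5] -/
theorem unfold_apply_one (n : ℕ) (ω : ℕ → Site 2) (i : ℕ) : unfold n ω i 1 = ω i 1 :=
  iterate_unfoldStep_apply_of_ne n ω (n + 1) i (by decide)

/-- The unfolding of an all-turn walk is all-turn. [cite: MadrasSlade1993, Proposition 3.1.5] -/
theorem turns_unfold {n : ℕ} {ω : ℕ → Site 2} (hω : ω ∈ saws 2 n) : turns n (unfold n ω) = turns n ω :=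
  turns_eq_of_apply_one_eq hω (unfold_mem_saws hω) fun i _ => unfold_apply_one n ω i

/-- **S5 `AllTurnUnfold`** (a-idea-2's `V9.AllTurnUnfold`, body verbatim): `h^{AT}(n) ≤ e^{3√n} b^{AT}(n)` — the
Hammersley–Welsh unfolding injects the all-turn half-space walks (up to the `e^{3√n}` codes) into the all-turn
bridges. [cite: MadrasSlade1993, Proposition 3.1.5] -/
theorem allTurnUnfold : ∀ n : ℕ,
    (allTurnHalfSpaceCount n : ℝ) ≤ Real.exp (3 * Real.sqrt n) * allTurnBridgeCount n := by
  classical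
  intro n
  unfold allTurnHalfSpaceCount allTurnBridgeCount allTurnHalfSpaceWalks allTurnBridges
  set T := (halfSpaceWalks 2 n).filter fun ω => turns n ω = n - 1 with hT
  have hTs : T ⊆ saws 2 n := fun ω hω =>
    (mem_halfSpaceWalks.1 (Finset.mem_filter.1 hω).1).1
  refine (card_le_exp_mul_card_image_unfold hTs).trans (mul_le_mul_of_nonneg_left ?_ (Real.exp_pos _).le)
  refine Nat.cast_le.2 (Finset.card_le_card fun β hβ => ?_)
  obtain ⟨ω, hω, rfl⟩ := Finset.mem_image.1 hβ
  obtain ⟨hωh, hωt⟩ := Finset.mem_filter.1 hω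
  exact Finset.mem_filter.2 ⟨unfold_mem_bridges hωh, by rw [turns_unfold (hTs hω), hωt]⟩

/-! ### All-turn walks: every internal vertex turns -/

/-- `turns N ω = N − 1` iff the walk turns at EVERY internal vertex. [cite: MadrasSlade1993, §1.1] -/
theorem turns_eq_sub_one_iff (N : ℕ) (ω : ℕ → Site 2) :
    turns N ω = N - 1 ↔ ∀ j, j + 2 ≤ N → turnAt N ω j := by
  classical
  unfold turns Zd.occ
  set F := (Finset.range (N + 1)).filter (turnAt N ω) with hF
  have hsub : F ⊆ Finset.range (N - 1) := by
    intro j hj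
    rw [hF, Finset.mem_filter] at hj
    have := hj.2.1
    rw [Finset.mem_range]; omega
  constructor
  · intro hcard j hj
    have hEq : F = Finset.range (N - 1) :=
      Finset.eq_of_subset_of_card_le hsub (by rw [Finset.card_range, hcard])
    have hjF : j ∈ F := by rw [hEq, Finset.mem_range]; omega
    rw [hF, Finset.mem_filter] at hjF
    exact hjF.2
  · intro hall
    have hEq : F = Finset.range (N - 1) := by
      refine Finset.Subset.antisymm hsub fun j hj => ?_
      rw [Finset.mem_range] at hj
      rw [hF, Finset.mem_filter, Finset.mem_range]
      exact ⟨by omega, hall j (by omega)⟩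
    rw [hEq, Finset.card_range]

/-! ### S6: parity of the steps of an all-turn bridge, and concatenation -/

/-- The first step of a bridge is `+e₀`. [cite: MadrasSlade1993, Definition 1.2.4] -/
theorem bridge_first_step {N : ℕ} {ω : ℕ → Site 2} (hω : ω ∈ bridges 2 N) (hN : 1 ≤ N) :
    ω 1 - ω 0 = Pi.single 0 1 := by
  obtain ⟨hs, hb⟩ := mem_bridges.1 hω
  have h01 : ω 0 0 < ω 1 0 := (hb 1 le_rfl hN).1
  obtain ⟨i, h | h⟩ := sub_eq_single_or_of_adj ((mem_saws.1 hs).2.2.1 0 (by omega))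
  · fin_cases i
    · exact h
    · exfalso
      have := congrFun h 0
      simp at this
      linarith
  · exfalso
    have := congrFun h 0
    fin_cases i <;> simp at this <;> linarith

/-- **Step parity in an all-turn bridge**: step `s` (`1 ≤ s ≤ N`) is horizontal iff `s` is odd (the first step is
`+e₀` and the types alternate). [cite: MadrasSlade1993, §1.2] -/
theorem allTurn_bridge_step_horizontal_iff {N : ℕ} {ω : ℕ → Site 2} (hω : ω ∈ bridges 2 N)
    (hall : ∀ j, j + 2 ≤ N → turnAt N ω j) : ∀ s, 1 ≤ s → s ≤ N → ((ω s - ω (s - 1)) 1 = 0 ↔ Odd s) := by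
  have hs := (mem_bridges.1 hω).1
  intro s hs1 hsN
  induction s with
  | zero => omega
  | succ s ih =>
    rcases Nat.eq_zero_or_pos s with rfl | hspos
    · rw [bridge_first_step hω hsN]
      simp
    · have hprev := ih hspos (by omega)
      have ht := (turnAt_iff_types hs (j := s - 1) (by omega)).1 (hall (s - 1) (by omega))
      have e1 : s - 1 + 1 = s := by omega
      have e2 : s - 1 + 2 = s + 1 := by omega
      rw [e1, e2] at ht
      rw [show s + 1 - 1 = s from rfl]
      rw [Nat.odd_add_one, ← hprev]
      tauto

/-- Turns of the concatenation before the junction. [cite: MadrasSlade1993, §1.2, eq. (1.2.15)] -/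
theorem turnAt_concatWalk_left {m n : ℕ} {ω υ : ℕ → Site 2} {j : ℕ} (hj : j + 2 ≤ m) (hmn : m ≤ n) :
    turnAt n (concatWalk m ω υ) j ↔ turnAt m ω j := by
  unfold turnAt
  rw [concatWalk_apply_of_le ω υ (by omega : j ≤ m), concatWalk_apply_of_le ω υ (by omega : j + 1 ≤ m),
    concatWalk_apply_of_le ω υ hj]
  constructor
  · rintro ⟨-, h⟩; exact ⟨hj, h⟩
  · rintro ⟨-, h⟩; exact ⟨by omega, h⟩

/-- Turns of the concatenation after the junction. [cite: MadrasSlade1993, §1.2, eq. (1.2.15)] -/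
theorem turnAt_concatWalk_right {m n : ℕ} {ω υ : ℕ → Site 2} (h0 : υ 0 = 0) {t : ℕ} (ht : t + 2 ≤ n) :
    turnAt (m + n) (concatWalk m ω υ) (m + t) ↔ turnAt n υ t := by
  unfold turnAt
  rw [show m + t + 2 = m + (t + 2) by omega, show m + t + 1 = m + (t + 1) by omega,
    concatWalk_apply_add ω υ h0, concatWalk_apply_add ω υ h0, concatWalk_apply_add ω υ h0]
  constructor
  · rintro ⟨-, h⟩; exact ⟨ht, fun heq => h (by rw [add_sub_add_left_eq_sub, add_sub_add_left_eq_sub, heq])⟩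
  · rintro ⟨-, h⟩
    exact ⟨by omega, fun heq => h (by rwa [add_sub_add_left_eq_sub, add_sub_add_left_eq_sub] at heq)⟩

/-- **S6 `AllTurnConcat`** (a-idea-2's `V9.AllTurnConcat`, body verbatim): `b^{AT}(2j)·b^{AT}(k) ≤ b^{AT}(2j+k)` — an
all-turn bridge of even length ends with a vertical step and every bridge starts with `+e₀`, so the concatenation
of the two is an all-turn bridge; concatenation is injective. [cite: MadrasSlade1993, §1.2, eq. (1.2.15)] -/
theorem allTurnConcat : ∀ j k : ℕ,
    allTurnBridgeCount (2 * j) * allTurnBridgeCount k ≤ allTurnBridgeCount (2 * j + k) := by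
  classical
  intro j k
  unfold allTurnBridgeCount allTurnBridges
  rw [← Finset.card_product]
  refine Finset.card_le_card_of_injOn (fun p => concatWalk (2 * j) p.1 p.2) ?_ ?_
  · rintro ⟨β₁, β₂⟩ hp
    simp only [Finset.mem_coe, Finset.mem_product, Finset.mem_filter] at hp
    obtain ⟨⟨hβ₁, ht₁⟩, hβ₂, ht₂⟩ := hp
    have hβ₂' : β₂ ∈ bridges 2 (2 * j + k - 2 * j) := by rwa [show 2 * j + k - 2 * j = k by omega]
    have hγ : concatWalk (2 * j) β₁ β₂ ∈ bridges 2 (2 * j + k) := concatWalk_mem_bridges (by omega) hβ₁ hβ₂'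
    rw [Finset.mem_coe, Finset.mem_filter]
    refine ⟨hγ, (turns_eq_sub_one_iff _ _).2 fun j' hj' => ?_⟩
    have hall₁ := (turns_eq_sub_one_iff _ _).1 ht₁
    have hall₂ := (turns_eq_sub_one_iff _ _).1 ht₂
    have h20 : β₂ 0 = 0 := (mem_saws.1 (mem_bridges.1 hβ₂).1).1
    rcases Nat.lt_or_ge (j' + 2) (2 * j + 1) with hlt | hge
    · -- inside the first piece
      exact (turnAt_concatWalk_left (by omega) (by omega)).2 (hall₁ j' (by omega))
    rcases Nat.lt_or_ge j' (2 * j) with hlt' | hge'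
    · -- the junction `j' = 2j - 1` (so `j ≥ 1`, `k ≥ 1`)
      have hj1 : j' = 2 * j - 1 := by omega
      have hγs := (mem_bridges.1 hγ).1
      rw [turnAt_iff_types hγs hj']
      have e1 : j' + 1 = 2 * j := by omega
      have e2 : j' + 2 = 2 * j + 1 := by omega
      rw [e1, e2, concatWalk_apply_of_le β₁ β₂ (le_refl (2 * j)),
        concatWalk_apply_of_le β₁ β₂ (by omega : j' ≤ 2 * j), concatWalk_apply_add β₁ β₂ h20 1,
        add_sub_cancel_left]
      -- last step of `β₁` is vertical, first step of `β₂` is `+e₀`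
      have hv : ¬ (β₁ (2 * j) - β₁ j') 1 = 0 := by
        rw [hj1]
        have := (allTurn_bridge_step_horizontal_iff hβ₁ hall₁ (2 * j) (by omega) le_rfl).not
        rw [this, Nat.not_odd_iff_even]
        exact even_two_mul j
      have hh : (β₂ 1) 1 = 0 := by
        have := bridge_first_step hβ₂ (by omega)
        rw [h20, sub_zero] at this
        rw [this]; simp
      simp only [hv, hh, not_true_eq_false]
    · -- inside the second piece
      obtain ⟨t, rfl⟩ : ∃ t, j' = 2 * j + t := ⟨j' - 2 * j, by omega⟩
      exact (turnAt_concatWalk_right h20 (by omega)).2 (hall₂ t (by omega))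
  · rintro ⟨β₁, β₂⟩ hp ⟨β₁', β₂'⟩ hp' h
    simp only [Finset.mem_coe, Finset.mem_product, Finset.mem_filter] at hp hp'
    obtain ⟨h1, h2⟩ := concatWalk_injective_pieces (mem_bridges.1 hp.1.1).1 (mem_bridges.1 hp.2.1).1
      (mem_bridges.1 hp'.1.1).1 (mem_bridges.1 hp'.2.1).1 h
    exact Prod.ext h1 h2

end Literature.Probability.RandomPlanarGeometry.SAW.Zd

end
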